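import Summits.ValiantsHypothesis.ValiantsHypothesis.Theorems.BarrierLeverPartitionMinorsHitByVPJointPeelDefs
import Summits.ValiantsHypothesis.ValiantsHypothesis.Theorems.BarrierLeverPartitionMinorsHitByVPSamePattern

/-!
# Route BarrierLever — item `PartitionMinorsHitByVP` (stmt-ValiantsHypothesis-19717):
# the JOINT PEEL — down-closed rows, a tie-free lowest digit on the column side

Helper file (`--supports stmt-ValiantsHypothesis-19717`; cell valiant-natproofs, rung V4, 𝒟-side door (c); prover
seat val-np-p6 gen 6). Definition-free. Closes NO item. The common generalisation of this seat's peel steps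
(`bbMatrix_det_ne_zero_peel` — balls; `spMatrix_det_ne_zero_peel` — self-pairs): the TOOLKIT form, from which every
«jointly peelable» pair (R, 𝒲) (seat memo RESIDUE-v8: ≈ 62 % of all labelled lower-set pairs at `h = 4`, ≈ 47 % at
`h = 5`, strictly more than the pairs of isomorphic complexes) is certified by replaying its certificate.

* **`colMatrix_det_ne_zero_peel`** — rows: a down-closed family `R` over `Fin (n+1)` (peel node `0`: `R = del ⊔ (0 + link)`,
  `link ⊆ del`); columns: arbitrary digit sets `W T ⊆ Fin k`; a digit `c₀` whose exponent is STRICTLY the smallest among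
  all digits used; bijections `κ₀ : Fam (del R) ≃ {T : c₀ ∉ W T}`, `κ₁ : Fam (link R) ≃ {T : c₀ ∈ W T}` (this is the
  «no tie» condition `#{T : c₀ ∈ W T} = |link R|` together with a choice of matching). THEN
  `det ≠ 0 ⇐ det(del R × (W ∘ κ₀)) ≠ 0 ∧ det(link R × (erase c₀ ∘ W ∘ κ₁)) ≠ 0`.
* `colMatrix_det_ne_zero_relabel` — permuting the NODE labels of the rows does not change non-vanishing (so the peeled node
  may be any node: relabel it to `0` first);
* base case `colMatrix_det_ne_zero_of_card_le_one`.

WHAT THIS IS NOT: a toolkit (implications); the class it generates is recursive («jointly peelable»), not closed-form;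
nothing on crux 14610 or VP vs VNP.
-/

set_option linter.dupNamespace false

namespace Summit.ValiantsHypothesis.ValiantsHypothesis.Theorems.BarrierLever.FrobeniusDoor

open Finset MvPolynomial Matrix

noncomputable section

variable (p : ℕ)

section Peel
variable [Fact p.Prime]

/-- **THE JOINT PEEL STEP** (see the module docstring). -/
theorem colMatrix_det_ne_zero_peel (n k : ℕ) (d : Fin k → ℕ) (F : Finset (Finset (Fin (n + 1))))
    (hF : IsDownClosedFam F) (W : Fam F → Finset (Fin k)) (c₀ : Fin k)
    (hmin : ∀ T, ∀ x ∈ W T, x ≠ c₀ → d c₀ < d x)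
    (κ₀ : Fam (famDel F) ≃ {T : Fam F // c₀ ∉ W T}) (κ₁ : Fam (famLink F) ≃ {T : Fam F // c₀ ∈ W T})
    (hA : (colMatrix p n k d (famDel F) (fun S => W (κ₀ S).1)).det ≠ 0)
    (hB : (colMatrix p n k d (famLink F) (fun S => (W (κ₁ S).1).erase c₀)).det ≠ 0) :
    (colMatrix p (n + 1) k d F W).det ≠ 0 := by
  classical
  -- abbreviations
  set R := MvPolynomial (Fin (n + 1)) (ZMod p) with hR
  set ψ := MvPolynomial.finSuccEquiv (ZMod p) (n + 1) with hψ
  set q : ℕ := p ^ d c₀ with hq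
  -- column weights through the two column equivalences
  set m₀ : Fam (famDel F) → ℕ := fun V => ballWt p k d (W (κ₀ V).1) with hm₀
  set m₁ : Fam (famLink F) → ℕ := fun V => ballWt p k d ((W (κ₁ V).1).erase c₀) with hm₁
  have hdvd₀ : ∀ V, p ^ (d c₀ + 1) ∣ m₀ V := by
    intro V
    refine Finset.dvd_sum fun x hx => pow_dvd_pow p (hmin _ x hx ?_)
    rintro rfl; exact (κ₀ V).2 hx
  have hdvd₁ : ∀ V, p ^ (d c₀ + 1) ∣ m₁ V := by
    intro V
    refine Finset.dvd_sum fun x hx => pow_dvd_pow p (hmin _ x (Finset.mem_of_mem_erase hx) ?_)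
    exact Finset.ne_of_mem_erase hx
  have hwt₁ : ∀ V, ballWt p k d (W (κ₁ V).1) = q + m₁ V := by
    intro V
    show ballWt p k d (W (κ₁ V).1) = p ^ d c₀ + ballWt p k d ((W (κ₁ V).1).erase c₀)
    unfold ballWt
    rw [← Finset.add_sum_erase _ _ (κ₁ V).2]
  set A : Matrix (Fam (famDel F)) (Fam (famDel F)) R := colMatrix p n k d (famDel F) (fun S => W (κ₀ S).1) with hAdef
  set B : Matrix (Fam (famLink F)) (Fam (famLink F)) R :=
    colMatrix p n k d (famLink F) (fun S => (W (κ₁ S).1).erase c₀) with hBdef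
  set A₁₂ : Matrix (Fam (famDel F)) (Fam (famLink F)) R :=
    Matrix.of fun S' W' => ballEta p n S'.1 ^ (q + m₁ W') with hA₁₂
  set σ := famSplit F with hσ
  -- columns: `inl ↔ c₀ ∉ W T` via `κ₀`, `inr ↔ c₀ ∈ W T` via `κ₁`
  set σc : Fam F ≃ Fam (famDel F) ⊕ Fam (famLink F) :=
    (Equiv.sumCompl (fun T : Fam F => c₀ ∈ W T)).symm.trans
      ((Equiv.sumCongr κ₁.symm κ₀.symm).trans (Equiv.sumComm _ _)) with hσc
  have hσc_inl : ∀ V : Fam (famDel F), σc.symm (Sum.inl V) = (κ₀ V).1 := by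
    intro V; simp [hσc, Equiv.sumCompl]
  have hσc_inr : ∀ V : Fam (famLink F), σc.symm (Sum.inr V) = (κ₁ V).1 := by
    intro V; simp [hσc, Equiv.sumCompl]
  set M := colMatrix p (n + 1) k d F W with hM
  -- the reindexed matrix, mapped to `R[T]`
  set PM : Matrix (Fam (famDel F) ⊕ Fam (famLink F)) (Fam (famDel F) ⊕ Fam (famLink F)) (Polynomial R) :=
    ψ.toRingEquiv.toRingHom.mapMatrix (Matrix.reindex σ σc M) with hPM
  have hdetPM : PM.det ≠ 0 ↔ M.det ≠ 0 := by
    rw [hPM, ← RingHom.map_det]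
    have hre : Matrix.reindex σ σc M = (Matrix.reindex σ σ M).submatrix id (σc.symm.trans σ) := by
      refine Matrix.ext fun i j => ?_
      simp [Matrix.reindex_apply, Matrix.submatrix_apply]
    rw [hre, Matrix.det_permute', Matrix.det_reindex_self, map_mul]
    have hs : (ψ.toRingEquiv.toRingHom ((Equiv.Perm.sign (σc.symm.trans σ) : ℤ) : MvPolynomial (Fin (n + 1 + 1)) (ZMod p))) ≠ 0 := by
      rcases Int.units_eq_one_or (Equiv.Perm.sign (σc.symm.trans σ)) with h1 | h1 <;> simp [h1]
    constructor
    · intro hne h0; exact hne (by rw [h0, map_zero, mul_zero])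
    · intro hne h0
      rcases mul_eq_zero.mp h0 with h' | h'
      · exact hs h'
      · exact hne (by simpa using h')
  -- its four blocks
  set P₁₁ : Matrix (Fam (famDel F)) (Fam (famDel F)) (Polynomial R) := A.map Polynomial.C with hP₁₁
  set P₁₂ : Matrix (Fam (famDel F)) (Fam (famLink F)) (Polynomial R) := A₁₂.map Polynomial.C with hP₁₂
  set P₂₁ : Matrix (Fam (famLink F)) (Fam (famDel F)) (Polynomial R) :=
    Matrix.of fun S' V' => (Polynomial.X + Polynomial.C (ballEta p n S'.1)) ^ m₀ V' with hP₂₁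
  set P₂₂ : Matrix (Fam (famLink F)) (Fam (famLink F)) (Polynomial R) :=
    Matrix.of fun S' W' => (Polynomial.X + Polynomial.C (ballEta p n S'.1)) ^ (q + m₁ W') with hP₂₂
  have hentry : ∀ i j, PM i j = ψ (ballEta p (n + 1) (σ.symm i).1 ^ ballWt p k d (W (σc.symm j))) := by
    intro i j
    simp only [hPM, RingHom.mapMatrix_apply, Matrix.map_apply, Matrix.reindex_apply, Matrix.submatrix_apply, hM,
      colMatrix, Matrix.of_apply]
    rfl
  have hψX : ψ (X 0) = Polynomial.X := by rw [hψ]; exact MvPolynomial.finSuccEquiv_X_zero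
  have hblocks : PM = Matrix.fromBlocks P₁₁ P₁₂ P₂₁ P₂₂ := by
    refine Matrix.ext fun i j => ?_
    rw [hentry]
    rcases i with S' | S' <;> rcases j with V' | V'
    · rw [Matrix.fromBlocks_apply₁₁, hP₁₁, Matrix.map_apply, hAdef, colMatrix, Matrix.of_apply, hσ,
        famSplit_symm_inl, hσc_inl, ballEta_map_succEmb, map_pow, finSuccEquiv_rename_succ, ← map_pow]
    · rw [Matrix.fromBlocks_apply₁₂, hP₁₂, Matrix.map_apply, hA₁₂, Matrix.of_apply, hσ, famSplit_symm_inl,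
        hσc_inr, ballEta_map_succEmb, hwt₁, map_pow, finSuccEquiv_rename_succ, ← map_pow]
    · rw [Matrix.fromBlocks_apply₂₁, hP₂₁, Matrix.of_apply, hσ, famSplit_symm_inr, hσc_inl,
        ballEta_insert_zero, map_pow, map_add, hψX, finSuccEquiv_rename_succ]
    · rw [Matrix.fromBlocks_apply₂₂, hP₂₂, Matrix.of_apply, hσ, famSplit_symm_inr, hσc_inr,
        ballEta_insert_zero, hwt₁, map_pow, map_add, hψX, finSuccEquiv_rename_succ]
  -- row differencing: subtract row `S'` (top block) from row `S' ∪ {0}` (bottom block)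
  set E : Matrix (Fam (famLink F)) (Fam (famDel F)) (Polynomial R) :=
    Matrix.of fun S' T' => if T' = famLinkIncl hF S' then 1 else 0 with hE
  have hEmul' : ∀ {κ : Type} (N : Matrix (Fam (famDel F)) κ (Polynomial R)) S' j,
      (E * N) S' j = N (famLinkIncl hF S') j := by
    intro κ N S' j
    rw [Matrix.mul_apply, Finset.sum_eq_single (famLinkIncl hF S')]
    · simp [hE]
    · intro T' _ hT'; simp [hE, hT']
    · intro h; exact absurd (Finset.mem_univ _) h
  set L : Matrix (Fam (famDel F) ⊕ Fam (famLink F)) (Fam (famDel F) ⊕ Fam (famLink F)) (Polynomial R) :=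
    Matrix.fromBlocks 1 0 (-E) 1 with hL
  have hdetL : L.det = 1 := by rw [hL, Matrix.det_fromBlocks_zero₁₂, Matrix.det_one, Matrix.det_one, mul_one]
  have hLP : L * PM = Matrix.fromBlocks P₁₁ P₁₂ (P₂₁ - E * P₁₁) (P₂₂ - E * P₁₂) := by
    rw [hblocks, hL, Matrix.fromBlocks_multiply]
    simp only [Matrix.one_mul, Matrix.zero_mul, add_zero, Matrix.neg_mul]
    congr 1 <;> abel
  -- divisibility of the differenced bottom blocks
  have h21 : ∀ S' V', ∃ g : Polynomial R, (P₂₁ - E * P₁₁) S' V' = Polynomial.X ^ q * (Polynomial.X * g) := by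
    intro S' V'
    obtain ⟨g₀, hg₀⟩ := X_pow_dvd_add_pow_sub p (R := R) (d c₀) _ (hdvd₀ V') (ballEta p n S'.1)
    have h1 : p ^ d c₀ + 1 ≤ p ^ (d c₀ + 1) := Nat.pow_lt_pow_right (Fact.out : p.Prime).one_lt (by omega)
    obtain ⟨r, hr⟩ := Nat.exists_eq_add_of_le h1
    rw [hr] at hg₀
    refine ⟨Polynomial.X ^ r * g₀, ?_⟩
    rw [Matrix.sub_apply, hEmul', hP₂₁, hP₁₁, Matrix.of_apply, Matrix.map_apply, hAdef, colMatrix, Matrix.of_apply]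
    show _ - Polynomial.C (ballEta p n S'.1 ^ m₀ V') = _
    rw [hg₀, hq]; ring
  have h22 : ∀ S' W', ∃ g : Polynomial R,
      (P₂₂ - E * P₁₂) S' W' = Polynomial.X ^ q * (Polynomial.C (B S' W') + Polynomial.X * g) := by
    intro S' W'
    obtain ⟨g, hg⟩ := add_pow_sub_eq_X_pow_mul p (R := R) (d c₀) _ (hdvd₁ W') (ballEta p n S'.1)
    refine ⟨g, ?_⟩
    rw [Matrix.sub_apply, hEmul', hP₂₂, hP₁₂, Matrix.of_apply, Matrix.map_apply, hA₁₂, Matrix.of_apply, hBdef, colMatrix,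
      Matrix.of_apply]
    exact hg
  choose H hH using h21
  choose G hG using h22
  set Q : Matrix (Fam (famDel F) ⊕ Fam (famLink F)) (Fam (famDel F) ⊕ Fam (famLink F)) (Polynomial R) :=
    Matrix.fromBlocks P₁₁ P₁₂ (Matrix.of fun S' V' => Polynomial.X * H S' V')
      (B.map Polynomial.C + Matrix.of fun S' W' => Polynomial.X * G S' W') with hQ
  have hfactor : L * PM = Matrix.fromBlocks 1 0 0 ((Polynomial.X : Polynomial R) ^ q • (1 : Matrix (Fam (famLink F)) (Fam (famLink F)) _)) * Q := by
    rw [hLP, hQ, Matrix.fromBlocks_multiply]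
    simp only [Matrix.one_mul, Matrix.zero_mul, add_zero, zero_add, Matrix.smul_mul, Matrix.one_mul]
    congr 1
    · ext S' V'; rw [hH, Matrix.smul_apply, Matrix.of_apply, smul_eq_mul]
    · ext S' W'; rw [hG, Matrix.smul_apply, Matrix.add_apply, Matrix.map_apply, Matrix.of_apply, smul_eq_mul]
  have hdetQ0 : (Polynomial.evalRingHom (0 : R)) Q.det = A.det * B.det := by
    rw [RingHom.map_det]
    have hQ0 : (Polynomial.evalRingHom (0 : R)).mapMatrix Q = Matrix.fromBlocks A A₁₂ 0 B := by
      refine Matrix.ext fun i j => ?_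
      rw [RingHom.mapMatrix_apply, Matrix.map_apply, hQ]
      rcases i with S' | S' <;> rcases j with V' | V'
      · simp [hP₁₁]
      · simp [hP₁₂]
      · simp
      · simp
    rw [hQ0, Matrix.det_fromBlocks_zero₂₁]
  have hdetQ : Q.det ≠ 0 := by
    intro h0
    apply mul_ne_zero hA hB
    rw [← hdetQ0, h0, map_zero]
  have hdetLP : (L * PM).det = (Polynomial.X : Polynomial R) ^ (q * Fintype.card (Fam (famLink F))) * Q.det := by
    rw [hfactor, Matrix.det_mul, Matrix.det_fromBlocks_zero₂₁, Matrix.det_one, one_mul, Matrix.det_smul,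
      Matrix.det_one, mul_one, ← pow_mul]
  -- conclude
  rw [← hdetPM]
  intro hM0
  have : (L * PM).det = 0 := by rw [Matrix.det_mul, hM0, mul_zero]
  rw [hdetLP] at this
  rcases mul_eq_zero.mp this with hX | hQ'
  · exact absurd hX (pow_ne_zero _ Polynomial.X_ne_zero)
  · exact hdetQ hQ'
end Peel

/-! ## Relabeling the nodes; the base case -/
section Tools
variable [Fact p.Prime]

/-- **Node relabeling.** For a permutation `π` of the nodes, the Moore matrix of the relabeled row family `π(R)` (same
column data, transported) is nonsingular iff the original one is: rename the node variables. Stated as an implication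
from the relabeled family. -/
theorem colMatrix_det_ne_zero_relabel (n k : ℕ) (d : Fin k → ℕ) (R : Finset (Finset (Fin n)))
    (W : Fam R → Finset (Fin k)) (π : Equiv.Perm (Fin n))
    (e : Fam R ≃ Fam (R.map (Finset.mapEmbedding π.toEmbedding).toEmbedding))
    (he : ∀ S : Fam R, (e S).1 = S.1.map π.toEmbedding)
    (h : (colMatrix p n k d (R.map (Finset.mapEmbedding π.toEmbedding).toEmbedding) (fun T => W (e.symm T))).det ≠ 0) :
    (colMatrix p n k d R W).det ≠ 0 := by
  classical
  -- rename node variables: `castSucc a ↦ castSucc (π a)`, `last ↦ last`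
  set τ : Fin (n + 1) ≃ Fin (n + 1) :=
    finSuccEquivLast.trans ((Equiv.optionCongr π).trans finSuccEquivLast.symm) with hτ
  have hτ1 : ∀ a : Fin n, τ (Fin.castSucc a) = Fin.castSucc (π a) := by intro a; simp [hτ]
  have hτ2 : τ (Fin.last n) = Fin.last n := by simp [hτ]
  set ρ : MvPolynomial (Fin (n + 1)) (ZMod p) →ₐ[ZMod p] MvPolynomial (Fin (n + 1)) (ZMod p) := rename τ with hρ
  have hEta : ∀ S : Finset (Fin n), ρ (ballEta p n S) = ballEta p n (S.map π.toEmbedding) := by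
    intro S
    simp only [hρ, ballEta, map_add, map_sum, rename_X, hτ1, hτ2, Finset.sum_map, Equiv.toEmbedding_apply]
  have hmat : ρ.mapMatrix (colMatrix p n k d R W) =
      (colMatrix p n k d (R.map (Finset.mapEmbedding π.toEmbedding).toEmbedding) (fun T => W (e.symm T))).submatrix
        e e := by
    refine Matrix.ext fun S T => ?_
    simp only [AlgHom.mapMatrix_apply, Matrix.map_apply, colMatrix, Matrix.of_apply, Matrix.submatrix_apply, map_pow,
      hEta, he, Equiv.symm_apply_apply]
  intro h0
  apply h
  have := ρ.map_det (colMatrix p n k d R W)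
  rw [hmat, Matrix.det_submatrix_equiv_self, h0, map_zero] at this
  exact this.symm

omit [Fact p.Prime] in
/-- **Base case.** A family with at most one member: the `colMatrix` is empty or `1 × 1` with entry `η^m`; its determinant
is nonzero (`p` prime). -/
theorem colMatrix_det_ne_zero_of_card_le_one [Fact p.Prime] (n k : ℕ) (d : Fin k → ℕ) (R : Finset (Finset (Fin n)))
    (W : Fam R → Finset (Fin k)) (hR : R.card ≤ 1) : (colMatrix p n k d R W).det ≠ 0 := by
  classical
  rcases isEmpty_or_nonempty (Fam R) with hE | ⟨⟨S⟩⟩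
  · rw [Matrix.det_isEmpty]; exact one_ne_zero
  · have hcard : Fintype.card (Fam R) = 1 := by
      have h1 : Fintype.card (Fam R) = R.card := by simp [Fam]
      have h2 : 0 < Fintype.card (Fam R) := Fintype.card_pos_iff.mpr ⟨S⟩
      omega
    rw [Matrix.det_eq_elem_of_card_eq_one hcard S, colMatrix, Matrix.of_apply]
    refine pow_ne_zero _ ?_
    -- `η_S ≠ 0`: evaluate at the point `last ↦ 1`, `castSucc a ↦ 0`
    intro h0
    have := congrArg (MvPolynomial.eval fun i : Fin (n + 1) => if i = Fin.last n then (1 : ZMod p) else 0) h0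
    simp only [ballEta, map_add, map_sum, MvPolynomial.eval_X, if_true, map_zero, Fin.castSucc_ne_last, if_false,
      Finset.sum_const_zero, add_zero] at this
    exact one_ne_zero this
end Tools

end

end Summit.ValiantsHypothesis.ValiantsHypothesis.Theorems.BarrierLever.FrobeniusDoor
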